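import Mathlib
import Summits.ValiantsHypothesis.ValiantsHypothesis.Theses.FreeSubtorus
import Summits.ValiantsHypothesis.ValiantsHypothesis.Theorems.BorderApolarityToricWitnessObstructionQPStubTorusBound
import Summits.ValiantsHypothesis.ValiantsHypothesis.Theorems.FreeSubtorusSubtorusCoveringStubIndepMatching
import Summits.ValiantsHypothesis.ValiantsHypothesis.Theorems.FreeSubtorusSubtorusCoveringStubRelabel
import Summits.ValiantsHypothesis.ValiantsHypothesis.Theorems.FreeSubtorusSubtorusCoveringStubTorusExtension
import Summits.ValiantsHypothesis.ValiantsHypothesis.Theorems.FreeSubtorusSubtorusCoveringStubSubstPer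
import Summits.ValiantsHypothesis.ValiantsHypothesis.Theorems.FreeSubtorusSubtorusCoveringStubSubstLifts
import Literature.Computability.AlgebraicComplexity.DeterminantalComplexityProofs
import Literature.Computability.AlgebraicComplexity.StandardFamiliesProofs
import Literature.Computability.AlgebraicComplexity.LRPencilOfMatrix
import Literature.Computability.AlgebraicComplexity.GrenetEquivariant

/-!
# `FreeSubtorus.SubtorusCovering` (crux stmt-ValiantsHypothesis-16134, route FreeSubtorus, rank 3)

**Statement.**  For `n ≥ 3`, every affine determinantal representation `B` of `per_n` over `ℂ`
(size `m`) that is equivariant with exact `GL_m × GL_m` lifts (`IsEquivariantDetRepr`) for the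
subtorus `T_Λ = closure {diag(d_k e_l) : ∏_k d_k^{Λ_i(inl k)} ∏_l e_l^{Λ_i(inr l)} = 1 (i < r)}` of
the row–column torus, `Λ : Fin r → (Fin n ⊕ Fin n) → ℤ` admissible (zero row-sums and zero
column-sums), satisfies `C(n, ⌊n/2⌋) ≤ m · 2^r`.

**Proof (line `pair-sacrifice`, `Cruxes/SubtorusCovering/Lines/pair_sacrifice.lean`).**  Write
`a_k = Λ(·)(inl k)`, `b_l = Λ(·)(inr l)`, `v_{kl} = a_k - b_l`.
(1) `stub_indepMatching`: a maximum-cardinality partial matching `(ι j, κ j)_{j<s}` with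
`ℚ`-independent differences has `s ≤ r`, and either `n ≤ s + 2` or every column of `Λ` is a
`ℚ`-combination (common denominator `N > 0`) of the matched differences (two-move augmentation,
zero ROW-sums).
(2) If `n ≤ s + 2`: `r ≥ n - 2` and `m ≥ n` (`totalDegree_le_of_hasDetRepr_holds`,
`totalDegree_perPoly_holds`) give `C(n,⌊n/2⌋) ≤ 2^{n-1} ≤ n · 2^{n-2} ≤ m · 2^r`.
(3) Otherwise `n = n' + s`, `n' ≥ 3`.  Relabel rows and columns so that the matched pairs are the
last `s` diagonal positions (`stub_relabel`, `rename (Prod.map ρ κ)`); extend `N`-th powers of the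
free two-sided torus across the sacrificed pairs inside `T_Λ` (`stub_torusExtension`; `ℂ` has
`N`-th roots, so every generator of the free torus is reached); substitute `x_{(n'+j,n'+j)} = 1`,
`0` elsewhere on the sacrificed rows/columns (`aeval g`): the result is an affine representation of
`per_{n'}` of the SAME size `m` (`stub_substPer`) with exact lifts of every generator of the full
two-sided torus (`stub_substLifts`), hence (`IsEquivariantDetRepr.of_generators`) the LANDED
`r = 0` theorem `Theorems.BorderApolarityToricWitnessObstructionQP.stub_torusBound`
(`RigidityForcesSymmetry.TorusBound` ≡ `RigidMinimalReps.TorusBound`: regularity, one generic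
prime torus element, canonical-subspace descent on permutation graphs, graded pigeonhole) gives
`2^{n'} - 1 ≤ m`, and `C(n,⌊n/2⌋) ≤ 2^{n-1} ≤ (2^{n'} - 1) · 2^s ≤ m · 2^r`.
Only the row half of admissibility is used; the bound obtained is the stronger `2^n - 2^s ≤ m · 2^r`.
-/

open Matrix MvPolynomial Finset
open Literature.Computability.AlgebraicComplexity

-- the mandated summit-side namespace repeats a component by design (single-conjunct summit)
set_option linter.dupNamespace false

namespace Summit.ValiantsHypothesis.ValiantsHypothesis.Theorems.FreeSubtorusSubtorusCovering

noncomputable section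

/-! ### Three elementary helpers -/

/-- An injection `Fin s ↪ Fin N` is the restriction of a permutation carrying it onto any other
injection `Fin s ↪ Fin N`. [folklore] -/
theorem exists_perm_extend_embedding {s N : ℕ} (ι τ : Fin s ↪ Fin N) :
    ∃ ρ : Equiv.Perm (Fin N), ∀ j, ρ (ι j) = τ j := by
  classical
  let e : {x // x ∈ Set.range ι} ≃ {x // x ∈ Set.range τ} :=
    ι.toEquivRange.symm.trans τ.toEquivRange
  refine ⟨e.extendSubtype, fun j => ?_⟩
  rw [Equiv.extendSubtype_apply_of_mem e (ι j) ⟨j, rfl⟩]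
  simp only [e, Equiv.trans_apply]
  rw [Function.Embedding.toEquivRange_symm_apply_self, Function.Embedding.toEquivRange_apply]

/-- The middle binomial coefficient is at most half the row sum: `C(N, ⌊N/2⌋) ≤ 2^{N-1}`
(`N ≥ 1`; Pascal and `Σ_i C(N-1, i) = 2^{N-1}`). [folklore] -/
theorem choose_middle_le_two_pow_pred (N : ℕ) (hN : 1 ≤ N) : N.choose (N / 2) ≤ 2 ^ (N - 1) := by
  obtain ⟨M, rfl⟩ : ∃ M, N = M + 1 := ⟨N - 1, by omega⟩
  simp only [Nat.add_sub_cancel]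
  rcases Nat.eq_zero_or_pos ((M + 1) / 2) with h0 | hpos
  · rw [h0, Nat.choose_zero_right]; exact Nat.one_le_two_pow
  · obtain ⟨j, hj⟩ : ∃ j, (M + 1) / 2 = j + 1 := ⟨(M + 1) / 2 - 1, by omega⟩
    rw [hj, Nat.choose_succ_succ, ← Nat.sum_range_choose M]
    have hjM : j + 1 < M + 1 := by omega
    calc M.choose j + M.choose (j + 1) = ∑ i ∈ ({j, j + 1} : Finset ℕ), M.choose i := by
          rw [Finset.sum_pair (by omega)]
      _ ≤ ∑ i ∈ Finset.range (M + 1), M.choose i := by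
          apply Finset.sum_le_sum_of_subset
          intro x hx
          simp only [Finset.mem_insert, Finset.mem_singleton] at hx
          rw [Finset.mem_range]; omega

/-- An algebra map by affine data preserves affineness: if every `g v` has total degree `≤ 1`, so
does `aeval g p` for `p` of total degree `≤ 1`. [folklore] -/
theorem totalDegree_aeval_le_one {σ τ : Type*} [Fintype σ] [DecidableEq σ]
    (g : σ → MvPolynomial τ ℂ) (hg : ∀ v, (g v).totalDegree ≤ 1) (p : MvPolynomial σ ℂ)
    (hp : p.totalDegree ≤ 1) : (MvPolynomial.aeval g p).totalDegree ≤ 1 := by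
  have hφ : MvPolynomial.aeval g p =
      C (coeff 0 p) + ∑ v, C (coeff (Finsupp.single v 1) p) * g v := by
    conv_lhs => rw [LRPencil.eq_affine_of_totalDegree_le_one p hp]
    simp [map_sum, MvPolynomial.algebraMap_eq]
  rw [hφ]
  refine (totalDegree_add _ _).trans (max_le (by simp) ?_)
  refine totalDegree_finsetSum_le fun v _ => (totalDegree_mul _ _).trans ?_
  rw [totalDegree_C, zero_add]
  exact hg v

/-! ### The crux -/

/-- **`FreeSubtorus.SubtorusCovering` (crux stmt-ValiantsHypothesis-16134).**  For `n ≥ 3`, an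
affine determinantal representation of `per_n` over `ℂ` of size `m`, equivariant with exact lifts
under the admissibly cut subtorus `T_Λ` (`r` generators of zero row- and column-sums), has
`C(n, ⌊n/2⌋) ≤ m · 2^r`.  Pair sacrifice: `m ≥ n` by degree; a maximum independent partial matching
of the difference vectors (`stub_indepMatching`, `s ≤ r` pairs); if `n ≤ s + 2` the bound is
arithmetic; otherwise relabel (`stub_relabel`), extend `N`-th powers of the free torus
(`stub_torusExtension`, roots in `ℂ`), substitute (`stub_substPer`, `stub_substLifts`,
`IsEquivariantDetRepr.of_generators`) and apply the landed `r = 0` theorem `stub_torusBound` to the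
fully torus-equivariant representation of `per_{n-s}` of the same size: `2^{n-s} - 1 ≤ m`, whence
`C(n,⌊n/2⌋) ≤ 2^{n-1} ≤ (2^{n-s} - 1) 2^s ≤ m 2^r`.
[cite: LandsbergRessayre2017, Thm. 2.8, §6] [cite: Vonzurgathen1987, Thm. 3.1] -/
theorem subtorusCovering_proof :
    Summit.ValiantsHypothesis.ValiantsHypothesis.Theses.FreeSubtorus.SubtorusCovering := by
  unfold Summit.ValiantsHypothesis.ValiantsHypothesis.Theses.FreeSubtorus.SubtorusCovering
  intro n hn m r Λ B hΛ hB
  classical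
  -- (0) the degree bound `n ≤ m`
  have hmn : n ≤ m := by
    have h1 := totalDegree_le_of_hasDetRepr_holds (k := ℂ) (σ := Fin n × Fin n) ⟨B, hB.1⟩
    have h2 : (perPoly (Fin n) ℂ).totalDegree = n := by
      rw [totalDegree_perPoly_holds (n := Fin n) (k := ℂ), Fintype.card_fin]
    rw [h2] at h1
    exact h1
  -- (1) the matching
  obtain ⟨s, ι, κ, hsr, hcase⟩ := stub_indepMatching n r Λ (fun i => (hΛ i).1)
  by_cases hdeg : n ≤ s + 2
  · -- degenerate ranks: `r ≥ s ≥ n - 2`, `m ≥ n ≥ 3`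
    calc n.choose (n / 2) ≤ 2 ^ (n - 1) := choose_middle_le_two_pow_pred n (by omega)
      _ = 2 * 2 ^ (n - 2) := by rw [← pow_succ']; congr 1; omega
      _ ≤ n * 2 ^ (n - 2) := Nat.mul_le_mul_right _ (by omega)
      _ ≤ m * 2 ^ r := Nat.mul_le_mul hmn (Nat.pow_le_pow_right (by norm_num) (by omega))
  -- main branch
  rcases hcase with h | ⟨N, hN, hrow, hcol⟩
  · exact absurd h hdeg
  obtain ⟨n', rfl⟩ : ∃ n', n = n' + s := ⟨n - s, by omega⟩
  have hn' : 3 ≤ n' := by omega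
  -- (2) relabel: sacrificed pairs to the last `s` diagonal positions
  obtain ⟨ρ, hρ⟩ := exists_perm_extend_embedding ι (Fin.natAddEmb n')
  obtain ⟨κ₀, hκ₀⟩ := exists_perm_extend_embedding κ (Fin.natAddEmb n')
  have hρ' : ∀ j, ρ.symm (Fin.natAdd n' j) = ι j := fun j => by
    rw [Equiv.symm_apply_eq]; exact (hρ j).symm
  have hκ₀' : ∀ j, κ₀.symm (Fin.natAdd n' j) = κ j := fun j => by
    rw [Equiv.symm_apply_eq]; exact (hκ₀ j).symm
  set Λ' : Fin r → (Fin (n' + s) ⊕ Fin (n' + s)) → ℤ := fun i =>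
    Sum.elim (fun k => Λ i (Sum.inl (ρ.symm k))) (fun l => Λ i (Sum.inr (κ₀.symm l))) with hΛ'
  set B₁ : Matrix (Fin m) (Fin m) (MvPolynomial (Fin (n' + s) × Fin (n' + s)) ℂ) :=
    B.map (MvPolynomial.rename (Prod.map ρ κ₀)) with hB₁def
  have hB₁ : IsEquivariantDetRepr (Subgroup.closure
      {γ : Matrix.GeneralLinearGroup (Fin (n' + s) × Fin (n' + s)) ℂ |
        ∃ d e : Fin (n' + s) → ℂˣ,
          (∀ i, (∏ k, (d k) ^ (Λ' i (Sum.inl k))) * (∏ l, (e l) ^ (Λ' i (Sum.inr l))) = 1) ∧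
          (γ : Matrix (Fin (n' + s) × Fin (n' + s)) (Fin (n' + s) × Fin (n' + s)) ℂ) =
            Matrix.diagonal (fun p => (d p.1 : ℂ) * (e p.2 : ℂ))})
      (perPoly (Fin (n' + s)) ℂ) B₁ :=
    stub_relabel (n' + s) r m Λ B ρ κ₀ hB
  -- (3) the integer relations, relabelled
  have hrow' : ∀ k : Fin n', ∃ a : Fin s → ℤ, ∀ i,
      (N : ℤ) * Λ' i (Sum.inl (Fin.castAdd s k)) =
        ∑ j, a j * (Λ' i (Sum.inl (Fin.natAdd n' j)) - Λ' i (Sum.inr (Fin.natAdd n' j))) := by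
    intro k
    obtain ⟨a, ha⟩ := hrow (ρ.symm (Fin.castAdd s k))
    refine ⟨a, fun i => ?_⟩
    simp only [hΛ', Sum.elim_inl, Sum.elim_inr, hρ', hκ₀']
    exact ha i
  have hcol' : ∀ l : Fin n', ∃ a : Fin s → ℤ, ∀ i,
      (N : ℤ) * Λ' i (Sum.inr (Fin.castAdd s l)) =
        ∑ j, a j * (Λ' i (Sum.inl (Fin.natAdd n' j)) - Λ' i (Sum.inr (Fin.natAdd n' j))) := by
    intro l
    obtain ⟨a, ha⟩ := hcol (κ₀.symm (Fin.castAdd s l))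
    refine ⟨a, fun i => ?_⟩
    simp only [hΛ', Sum.elim_inl, Sum.elim_inr, hρ', hκ₀']
    exact ha i
  -- (4) the extension property of the free torus (roots of `N`-th powers exist in `ℂ`)
  have hext : ∀ d' e' : Fin n' → ℂ, (∀ k, d' k ≠ 0) → (∀ l, e' l ≠ 0) →
      ∃ d e : Fin (n' + s) → ℂˣ,
        (∀ i, (∏ k, (d k) ^ (Λ' i (Sum.inl k))) * (∏ l, (e l) ^ (Λ' i (Sum.inr l))) = 1) ∧
        (∀ k l, (d (Fin.castAdd s k) : ℂ) * (e (Fin.castAdd s l) : ℂ) = d' k * e' l) ∧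
        (∀ j, (d (Fin.natAdd n' j) : ℂ) * (e (Fin.natAdd n' j) : ℂ) = 1) := by
    intro d' e' hd' he'
    choose dr hdr using fun k => IsAlgClosed.exists_pow_nat_eq (d' k) hN
    choose er her using fun l => IsAlgClosed.exists_pow_nat_eq (e' l) hN
    have hdr0 : ∀ k, dr k ≠ 0 := fun k h0 => hd' k (by rw [← hdr k, h0, zero_pow hN.ne'])
    have her0 : ∀ l, er l ≠ 0 := fun l h0 => he' l (by rw [← her l, h0, zero_pow hN.ne'])
    obtain ⟨d, e, hrel, hd, he, hde⟩ := stub_torusExtension n' s r Λ' N hN hrow' hcol'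
      (fun k => Units.mk0 (dr k) (hdr0 k)) (fun l => Units.mk0 (er l) (her0 l))
    refine ⟨d, e, hrel, fun k l => ?_, fun j => ?_⟩
    · rw [hd k, he l, Units.val_pow_eq_pow_val, Units.val_pow_eq_pow_val, Units.val_mk0,
        Units.val_mk0, hdr k, her l]
    · rw [← Units.val_mul, hde j, Units.val_one]
  -- (5) the substitution
  let g : Fin (n' + s) × Fin (n' + s) → MvPolynomial (Fin n' × Fin n') ℂ := fun p =>
    Fin.addCases (motive := fun _ => MvPolynomial (Fin n' × Fin n') ℂ)
      (fun k => Fin.addCases (motive := fun _ => MvPolynomial (Fin n' × Fin n') ℂ)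
        (fun l => X (k, l)) (fun _ => 0) p.2)
      (fun j => Fin.addCases (motive := fun _ => MvPolynomial (Fin n' × Fin n') ℂ)
        (fun _ => 0) (fun j' => if j = j' then 1 else 0) p.2)
      p.1
  have hg₁ : ∀ k l, g (Fin.castAdd s k, Fin.castAdd s l) = X (k, l) := fun k l => by
    simp [g]
  have hg₂ : ∀ k j, g (Fin.castAdd s k, Fin.natAdd n' j) = 0 := fun k j => by
    simp [g]
  have hg₃ : ∀ j l, g (Fin.natAdd n' j, Fin.castAdd s l) = 0 := fun j l => by
    simp [g]
  have hg₄ : ∀ j j', g (Fin.natAdd n' j, Fin.natAdd n' j') = if j = j' then 1 else 0 :=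
    fun j j' => by simp [g]
  have hgdeg : ∀ p, (g p).totalDegree ≤ 1 := by
    rintro ⟨a, b⟩
    induction a using Fin.addCases <;> induction b using Fin.addCases
    · rw [hg₁]; exact (totalDegree_X _).le
    · rw [hg₂]; simp
    · rw [hg₃]; simp
    · rw [hg₄]; split_ifs <;> simp
  set B₂ : Matrix (Fin m) (Fin m) (MvPolynomial (Fin n' × Fin n') ℂ) :=
    B₁.map (MvPolynomial.aeval g) with hB₂def
  have haff₂ : ∀ i j, (B₂ i j).totalDegree ≤ 1 := fun i j => by
    rw [hB₂def, Matrix.map_apply]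
    exact totalDegree_aeval_le_one g hgdeg _ (hB₁.1.1 i j)
  have hdet₂ : B₂.det = perPoly (Fin n') ℂ := by
    rw [hB₂def, ← AlgHom.mapMatrix_apply, ← AlgHom.map_det, hB₁.1.2,
      stub_substPer n' s g hg₁ hg₂ hg₃ hg₄]
  have hlifts := stub_substLifts n' s r m Λ' B₁ g hg₁ hg₂ hg₃ hg₄ hext hB₁
  have hB₂ : IsEquivariantDetRepr (Subgroup.closure
      {γ' : Matrix.GeneralLinearGroup (Fin n' × Fin n') ℂ | ∃ d' e' : Fin n' → ℂ,
        (γ' : Matrix (Fin n' × Fin n') (Fin n' × Fin n') ℂ) =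
          Matrix.diagonal (fun p => d' p.1 * e' p.2)}) (perPoly (Fin n') ℂ) B₂ :=
    IsEquivariantDetRepr.of_generators ⟨haff₂, hdet₂⟩ hlifts
  -- (6) the landed `r = 0` theorem and the arithmetic
  have hbound : 2 ^ n' - 1 ≤ m :=
    Summit.ValiantsHypothesis.ValiantsHypothesis.Theorems.BorderApolarityToricWitnessObstructionQP.stub_torusBound
      n' hn' m B₂ hB₂
  calc (n' + s).choose ((n' + s) / 2) ≤ 2 ^ (n' + s - 1) :=
        choose_middle_le_two_pow_pred _ (by omega)
    _ = 2 ^ (n' - 1) * 2 ^ s := by rw [← pow_add]; congr 1; omega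
    _ ≤ (2 ^ n' - 1) * 2 ^ s := by
        apply Nat.mul_le_mul_right
        have : 2 ^ n' = 2 * 2 ^ (n' - 1) := by rw [← pow_succ']; congr 1; omega
        omega
    _ ≤ m * 2 ^ r := Nat.mul_le_mul hbound (Nat.pow_le_pow_right (by norm_num) hsr)

end

end Summit.ValiantsHypothesis.ValiantsHypothesis.Theorems.FreeSubtorusSubtorusCovering
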